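import Mathlib
import Literature.AlgebraicGeometry.Resolution.AugmentationIdeal
import Literature.AlgebraicGeometry.Resolution.RegularHomReduced
import Summits.ResolutionOfSingularities.ResolutionOfSingularities.Theorems.WildQuotientsWildQuotientResolutionInvolutionReesParity
import Summits.ResolutionOfSingularities.ResolutionOfSingularities.Theorems.WildQuotientsWildQuotientResolutionInvolutionFixedLocusRegularGlobal

/-!
# Involutions with `2` invertible on a regular ring: `I_ι` is radical, and so is its invariant contraction

(crux stmt-ResolutionOfSingularities-15640 `WildQuotients.WildQuotientResolution`, line `Sketch`,
sector `|G| = p`; RUNG V5 of `L/w45c/CHAIN.md` v8.4, brick B7/`HP₂`, card `mu2-strata-kl-twice`;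
res-L1-w45c-plan-1 NOTE 2026-08-27T12:55:40Z «J₀ := K = I_τ² ∩ R^τ = I_τ ∩ R^τ … radical because
I_τ is — R/I_τ regular — and K is its contraction»; offered by this seat 13:09Z (o2).
[OURS · L1 W4.5c] — NOT a statement of any manuscript; replaces the role of no printed item.
Prover res-L1-w45c-stub-3.)

* `InvolutionExit.isRadical_augIdeal` — for a regular ring `R` and an involution `ι` with `2 ∈ Rˣ`,
  `I_ι` is a radical ideal (`R ⧸ I_ι` is regular, `isRegularRing_quotient_augIdeal`, hence reduced).
* `InvolutionExit.mem_augIdeal_iff_mem_sq_of_invariant` — an INVARIANT element lies in `I_ι` iff it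
  lies in `I_ι²` (H3 at `n = 1`): `I_ι ∩ R₊ = I_ι² ∩ R₊ = K ∩ R₊`.
* `InvolutionExit.isRadical_comap_augIdeal` — the contraction of `I_ι` along any ring map into `R`
  (e.g. the inclusion of the invariant subring `R₊`) is radical; with the previous item, the centre
  `J₀ = K ∩ R₊` of HP₂ is radical.
-/

-- single-problem summit: the doubled namespace component `ResolutionOfSingularities` is forced
set_option linter.dupNamespace false

noncomputable section

namespace Summit.ResolutionOfSingularities.ResolutionOfSingularities.Theorems.WildQuotientResolution.InvolutionExit

open Literature.AlgebraicGeometry.Resolution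

variable {R : Type} [CommRing R] (ι : R ≃+* R) (hι : ∀ x, ι (ι x) = x)

include hι in
/-- **`I_ι` is radical** on a regular ring (`2` invertible). [OURS · L1 W4.5c] [folklore] -/
theorem isRadical_augIdeal [IsRegularRing R] (h2 : IsUnit (2 : R)) : (augIdeal ι).IsRadical := by
  haveI : IsRegularRing (R ⧸ augIdeal ι) := isRegularRing_quotient_augIdeal ι hι h2
  haveI : IsReduced (R ⧸ augIdeal ι) := IsRegularRing.isReduced' _
  exact (Ideal.isRadical_iff_quotient_reduced _).mpr inferInstance

include hι in
/-- `I_ι = √(I_ι²)` on a regular ring (`2` invertible). [OURS · L1 W4.5c] [folklore] -/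
theorem radical_sq_augIdeal [IsRegularRing R] (h2 : IsUnit (2 : R)) :
    (augIdeal ι ^ 2).radical = augIdeal ι := by
  rw [Ideal.radical_pow _ (by norm_num), (isRadical_augIdeal ι hι h2).radical]

include hι in
/-- An INVARIANT element lies in `I_ι` iff it lies in `I_ι²` (any commutative ring, `2` invertible):
`I_ι ∩ R₊ = K ∩ R₊`. [OURS · L1 W4.5c, card `mu2-strata-kl-twice` H3 at `n = 1`] [folklore] -/
theorem mem_augIdeal_iff_mem_sq_of_invariant (h2 : IsUnit (2 : R)) (x : R) (hx : ι x = x) :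
    x ∈ augIdeal ι ↔ x ∈ augIdeal ι ^ 2 := by
  have h := mem_pow_iff_mem_pow_two_mul_of_invariant ι hι h2 1 x hx
  rwa [pow_one] at h

include hι in
/-- The contraction of `I_ι` along any ring map (e.g. the inclusion of the invariants) is radical.
[OURS · L1 W4.5c] [folklore] -/
theorem isRadical_comap_augIdeal [IsRegularRing R] (h2 : IsUnit (2 : R)) {S : Type} [CommRing S]
    (f : S →+* R) : ((augIdeal ι).comap f).IsRadical :=
  (isRadical_augIdeal ι hι h2).comap f

include hι in
/-- The contraction of `K = I_ι²` along a ring map WITH INVARIANT IMAGE (e.g. the inclusion of `R₊`)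
equals the contraction of `I_ι` (any commutative ring), hence is radical on a regular ring. [OURS · L1 W4.5c] [folklore] -/
theorem comap_sq_augIdeal_eq (h2 : IsUnit (2 : R)) {S : Type} [CommRing S]
    (f : S →+* R) (hf : ∀ s, ι (f s) = f s) :
    (augIdeal ι ^ 2).comap f = (augIdeal ι).comap f := by
  ext s
  rw [Ideal.mem_comap, Ideal.mem_comap, ← mem_augIdeal_iff_mem_sq_of_invariant ι hι h2 (f s) (hf s)]

end Summit.ResolutionOfSingularities.ResolutionOfSingularities.Theorems.WildQuotientResolution.InvolutionExit

end
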